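import Summits.Parity.BatemanHorn.Theses.AlmostPrimeZeros

/-!
# `SystemLSDRealSegment` — negative-side support: the degenerate instance `k = 0` holds

Support lemmas for the crux `Summit.Parity.BatemanHorn.Theses.AlmostPrimeZeros.SystemLSDRealSegment`
(stmt-Parity-11292), from the standing disprover's work file `Cruxes/SystemLSDRealSegment/Disproof.lean`:
the empty family is a Bateman–Horn system with `C(∅) = 1`, and the `k = 0` instance of the crux holds with
`Λ ≡ 1`. (So no refutation can come from the empty system; the prover's `k = 0` branch is ready-made.)
-/

open Filter Polynomial Finset
open scoped Topology

namespace Summit.Parity.BatemanHorn.Theorems.SystemLSDRealSegment.Negative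

open Literature.NumberTheory.Sieve

/-- `ω_∅(p) = 0`: the empty product is `1`, never divisible by a prime. [folklore] -/
theorem polyRootCountMod_fin_zero (f : Fin 0 → ℤ[X]) {p : ℕ} (hp : p.Prime) : polyRootCountMod f p = 0 := by
  unfold polyRootCountMod
  simp only [Finset.univ_eq_empty, Finset.prod_empty, Finset.card_eq_zero, Finset.filter_eq_empty_iff]
  intro n _ h
  exact hp.not_dvd_one (by exact_mod_cast h)

/-- The empty family IS a Bateman–Horn system (all four fields vacuous / trivial). [folklore] -/
theorem isBatemanHornSystem_fin_zero (f : Fin 0 → ℤ[X]) : IsBatemanHornSystem f where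
  irreducible i := i.elim0
  leadingCoeff_pos i := i.elim0
  pairwise_not_associated i := i.elim0
  hasNoFixedPrimeDivisor p hp := by rw [polyRootCountMod_fin_zero f hp]; exact hp.pos

/-- `C(∅) = 1`: every ordered partial product equals `1`. [folklore] -/
theorem batemanHornConst_fin_zero (f : Fin 0 → ℤ[X]) : batemanHornConst f = 1 := by
  have : batemanHornPartial f = fun _ => 1 := by
    funext x
    unfold batemanHornPartial
    refine Finset.prod_eq_one fun p hp => ?_
    rw [polyRootCountMod_fin_zero f (Nat.prime_of_mem_primesLE hp)]
    simp
  rw [batemanHornConst, this]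
  exact tendsto_const_nhds.limUnder_eq

/-- `x⁻¹ (x + 1) → 1`. [folklore] -/
theorem tendsto_inv_mul_succ : Tendsto (fun x : ℕ => (x : ℝ)⁻¹ * (x + 1)) atTop (𝓝 1) := by
  have h : Tendsto (fun x : ℕ => 1 + (x : ℝ)⁻¹) atTop (𝓝 1) := by
    simpa using tendsto_const_nhds.add (tendsto_inv_atTop_nhds_zero_nat (𝕜 := ℝ))
  refine h.congr' ?_
  filter_upwards [eventually_ne_atTop 0] with x hx
  have : (x : ℝ) ≠ 0 := by exact_mod_cast hx
  field_simp

/-- The `k = 0` instance of `SystemLSDRealSegment` HOLDS (with `Λ ≡ 1`): the conclusion of the crux for every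
family `f : Fin 0 → ℤ[X]`, stated verbatim. [folklore] -/
theorem systemLSDRealSegment_fin_zero (f : Fin 0 → ℤ[X]) (_hf : IsBatemanHornSystem f) :
    ∃ Λ : ℂ → ℂ, DifferentiableOn ℂ Λ (Metric.ball 0 2) ∧ Λ 0 = (batemanHornConst f : ℂ) ∧
      ∀ y : ℝ, 5 / 4 < y → y < 7 / 4 → Filter.Tendsto (fun x : ℕ => (x : ℂ)⁻¹ *
        Complex.exp (((0 : ℕ) : ℂ) * (1 - (y : ℂ)) * (Real.log (Real.log x) : ℂ)) *
        ∑ n ∈ Finset.range (x + 1), (y : ℂ) ^ (∑ i, (((f i).eval (n : ℤ)).toNat.factorization.sum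
          fun _ v => min v 2))) Filter.atTop (nhds (Λ y * Complex.exp (((y : ℂ) - 1) *
          (Real.log (∏ i, ((f i).natDegree : ℝ)) : ℂ)) * (Complex.Gamma y)⁻¹ ^ (0 : ℕ))) := by
  refine ⟨fun _ => 1, differentiableOn_const 1, by rw [batemanHornConst_fin_zero]; simp, fun y _ _ => ?_⟩
  have htarget : (1 : ℂ) * Complex.exp (((y : ℂ) - 1) * (Real.log (∏ i : Fin 0, ((f i).natDegree : ℝ)) : ℂ)) *
      (Complex.Gamma y)⁻¹ ^ 0 = ((1 : ℝ) : ℂ) := by simp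
  rw [htarget]
  have := (Complex.continuous_ofReal.tendsto (1 : ℝ)).comp tendsto_inv_mul_succ
  refine this.congr fun x => ?_
  simp only [Function.comp_apply, Finset.univ_eq_empty, Finset.sum_empty, pow_zero, Finset.sum_const,
    Finset.card_range, nsmul_eq_mul, mul_one, Nat.cast_zero, zero_mul, Complex.exp_zero]
  push_cast
  ring

/-- … and this is literally the `k = 0` case of the route decl. [folklore] -/
example (h : Summit.Parity.BatemanHorn.Theses.AlmostPrimeZeros.SystemLSDRealSegment) (f : Fin 0 → ℤ[X])
    (hf : IsBatemanHornSystem f) := h 0 f hf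

end Summit.Parity.BatemanHorn.Theorems.SystemLSDRealSegment.Negative
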